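/-
Copyright: the b2b-balaban T⁴-continuum CRUX team, row NE7b OWNER lineage `t4-ne7b-p1` (gen 145). Project licence.
-/
import Summits.QuantumFields.BalabanUV.T4Continuum.Spine.NE7b.SupFourthFormPsiContDiff
import Summits.QuantumFields.BalabanUV.T4Continuum.Spine.NE7b.SupFourthCumulantForm
import Summits.QuantumFields.BalabanUV.T4Continuum.Spine.NE7b.SupBlockDressedStep

/-!
# THE FOURTH-DERIVATIVE DISPLAY IS `C¹` IN THE BACKGROUND; ITS FRÉCHET DERIVATIVE IS CONTINUOUS (CONTINUITY OF THE TOP DERIVATIVE,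
# SCOPING-d16 (4), third file; (637) one regularity class up).  (637) proved (516)'s RAW display and (521)'s CENTRED display
# `ψ ↦ ∂⁴W(ψ)[h,k,l,m]` `DifferentiableAt` every background by `fun_prop` over sixteen differentiable moments (`Z ≠ 0` by (410)).  With the
# `C¹` atoms of (644) (`Z, G, H, Φ`) and (645) (the `Ψ`-moment) the SAME rational expression is `ContDiffAt ℝ 1` every `ψ₀` (`fun_prop` with
# `ContDiffAt.mul∕add∕sub∕inv∕pow`), hence `ContDiff ℝ 1`, hence — THE END — `fderiv ℝ (ψ ↦ ∂⁴W(ψ)[h,k,l,m])` is CONTINUOUS in `ψ`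
# (`ContDiff.continuous_fderiv`), for `U ∈ C⁵` with bounded `U″…U⁽⁵⁾`, `U⁽⁵⁾` continuous, under the regulator, directions of norm `≤ 1` (row
# NE7b, node U5c; (644), (645), (521) `raw_eq_centred`, (410) `block_Z_pos` BY NAME; [folklore]).  USE: the output's fifth-order object `P(ψ)`
# ((639)) is assembled from `fderiv ℝ (ψ ↦ ∂⁴W(ψ)[e_n;e_x,e_y,e_z])` by constant continuous (bi)linear operations ((532) identifies
# `fderiv(T(·)[e_x,e_y,e_z])ψ[e_n]` with the display), so `P` is continuous — the input's `hU₅c` reproduced (next file); NO fifth display is written.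

Cell `pub-balaban`, sub-cell `t4`, spine estimate NE7b (`T4WeightBudget.RelWeightBound`; the cell's OWN estimate — NOT PRINTED in
[Bałaban 1983–89], NOT PROVED).  Crux-route work under `Spine/NE7b/` by the row OWNER (`t4-ne7b-p1` gen 145, file (646)) under FREEZE
(0)'s crux-prover clause; NOTHING of Bałaban's is named as a Lean object, valued or asserted; no `T4Continuum/Support` leaf typed; no
`def`, no notation; zero `sorry`.  Imports (BY NAME): the OWNER's (645) `…SupFourthFormPsiContDiff` ((644) through it), (521)
`…SupFourthCumulantForm`, (410) `…SupBlockDressedStep`.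

WHAT IS PROVED ([folklore]): §1 `contDiffAt_fourth_form_raw`; §2 THE END **`continuous_fderiv_fourth_form`**; §3 toy.

HONEST (what this is NOT).  Regularity bookkeeping; the continuity of the packaged `5`-linear map `P` is the next file; `ContDiff ℝ 5` of
`W` as ONE object is NOT claimed (the class works derivative by derivative); `U ∈ C⁵` with bounded derivatives and the regulator are
hypotheses; scalar skeleton ((A3), NC-NE7b-α UNRULED); nothing of Bałaban's asserted.  BY-NAME EFFECT ON THE WALL: NONE.  NE7b NOT PRINTED ∕
NOT PROVED; spine PROVED 0∕9; rung (B)+1 — the programme's measures remain FINITE-torus statements; NOT the mass gap, NOT Clay.  HONEST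
DEPENDENCY: continuum YM on T⁴ ⇐ BetaPertH ∧ nine spine estimates (0∕9 proved); BetaPertH ⇐ (D1) ∧ (D4) ∧ CAP+tail; G-an2-4 gates asym, D1
and NE2∕3∕4.
-/

set_option autoImplicit false
set_option maxSynthPendingDepth 4

noncomputable section

namespace Summit.QuantumFields.BalabanUV.T4Continuum.NE7b.SupFourthFormContDiff

open MeasureTheory ProbabilityTheory Finset Real Matrix
open scoped Topology
open SupBlockDressedStep (block_Z_pos)
open SupTiltedMomentContDiff (contDiff_one_Z contDiff_one_G contDiff_one_H contDiff_one_Phi)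
open SupFourthCumulantForm (raw_eq_centred)
open SupFourthFormPsiContDiff (contDiff_one_psi_moment)

variable {ι : Type} [Fintype ι] [DecidableEq ι]

section Main

variable {Γ : Matrix ι ι ℝ} {γop : ℝ} {U : EuclideanSpace ℝ ι → ℝ} {U' : EuclideanSpace ℝ ι → EuclideanSpace ℝ ι →L[ℝ] ℝ}
  {U'' : EuclideanSpace ℝ ι → EuclideanSpace ℝ ι →L[ℝ] EuclideanSpace ℝ ι →L[ℝ] ℝ}
  {U₃ : EuclideanSpace ℝ ι → EuclideanSpace ℝ ι →L[ℝ] EuclideanSpace ℝ ι →L[ℝ] EuclideanSpace ℝ ι →L[ℝ] ℝ}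
  {U₄ : EuclideanSpace ℝ ι → EuclideanSpace ℝ ι →L[ℝ] EuclideanSpace ℝ ι →L[ℝ] EuclideanSpace ℝ ι →L[ℝ]
    EuclideanSpace ℝ ι →L[ℝ] ℝ}
  {U₅ : EuclideanSpace ℝ ι → EuclideanSpace ℝ ι →L[ℝ] EuclideanSpace ℝ ι →L[ℝ] EuclideanSpace ℝ ι →L[ℝ]
    EuclideanSpace ℝ ι →L[ℝ] EuclideanSpace ℝ ι →L[ℝ] ℝ}
  {κ₀ κ₁ a τ δ θ κ₂ κ₃ κ₄ κ₅ : ℝ} {h k l m : EuclideanSpace ℝ ι}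

/-! ## §1. The raw display is `C¹` in the background -/

set_option maxHeartbeats 4000000 in
/-- **(516)'s RAW fourth-derivative display, as a function of the background, is `ContDiffAt ℝ 1` every `ψ₀`** (directions of norm `≤ 1`;
`fun_prop` over the sixteen `C¹` moments of (644)∕(645)). [folklore] -/
theorem contDiffAt_fourth_form_raw (hΓ : Γ.PosSemidef) (hΓop : (γop • (1 : Matrix ι ι ℝ) - Γ).PosSemidef) (Y : Finset ι)
    (hUd : ∀ φ : EuclideanSpace ℝ ι, HasFDerivAt U (U' φ) φ) (hU'd : ∀ φ : EuclideanSpace ℝ ι, HasFDerivAt U' (U'' φ) φ)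
    (hU''d : ∀ φ : EuclideanSpace ℝ ι, HasFDerivAt U'' (U₃ φ) φ) (hU₃d : ∀ φ : EuclideanSpace ℝ ι, HasFDerivAt U₃ (U₄ φ) φ)
    (hU₄d : ∀ φ : EuclideanSpace ℝ ι, HasFDerivAt U₄ (U₅ φ) φ) (hU₅c : Continuous U₅) (hκ₀ : 0 ≤ κ₀) (hκ₁ : 0 ≤ κ₁) (ha : 0 ≤ a)
    (hτ : 0 < τ) (hδ : 0 < δ) (hθ1 : θ < 1) (hκθ : (2 * κ₀ * (1 + τ) + 4 * δ) * γop ≤ θ)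
    (hstab : ∀ φ : EuclideanSpace ℝ ι, -(κ₀ * ∑ x ∈ Y, φ x ^ 2) ≤ U φ) (hU'b : ∀ φ : EuclideanSpace ℝ ι, ‖U' φ‖ ≤ κ₁ * (a + ∑ x ∈ Y, φ x ^ 2))
    (hθ0 : 0 < θ) (hU''b : ∀ φ : EuclideanSpace ℝ ι, ‖U'' φ‖ ≤ κ₂) (hU₃b : ∀ φ : EuclideanSpace ℝ ι, ‖U₃ φ‖ ≤ κ₃)
    (hU₄b : ∀ φ : EuclideanSpace ℝ ι, ‖U₄ φ‖ ≤ κ₄) (hU₅b : ∀ φ : EuclideanSpace ℝ ι, ‖U₅ φ‖ ≤ κ₅) (ψ₀ : EuclideanSpace ℝ ι) (hh : ‖h‖ ≤ 1)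
    (hk : ‖k‖ ≤ 1) (hl : ‖l‖ ≤ 1) (hm : ‖m‖ ≤ 1) :
    ContDiffAt ℝ 1 (fun ψ : EuclideanSpace ℝ ι => ((∫ ω : EuclideanSpace ℝ ι, exp (-U (ω + ψ)) ∂(multivariateGaussian 0 Γ)))⁻¹ * (∫ ω :
        EuclideanSpace ℝ ι, exp (-U (ω + ψ)) * (U₄ (ω + ψ) m h k l - U' (ω + ψ) k * U₃ (ω + ψ) m h l - U'' (ω + ψ) h l * U'' (ω + ψ) m k - U'' (ω +
        ψ) h k * U'' (ω + ψ) m l - U' (ω + ψ) l * U₃ (ω + ψ) m h k - U' (ω + ψ) h * U₃ (ω + ψ) m k l - U'' (ω + ψ) k l * U'' (ω + ψ) m h + U' (ω +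
        ψ) h * U' (ω + ψ) k * U'' (ω + ψ) m l + U' (ω + ψ) h * U' (ω + ψ) l * U'' (ω + ψ) m k + U' (ω + ψ) k * U' (ω + ψ) l * U'' (ω + ψ) m h - (U₃
        (ω + ψ) h k l - U' (ω + ψ) k * U'' (ω + ψ) h l - U'' (ω + ψ) h k * U' (ω + ψ) l - U' (ω + ψ) h * U'' (ω + ψ) k l + U' (ω + ψ) h * U' (ω + ψ)
        k * U' (ω + ψ) l) * U' (ω + ψ) m) ∂(multivariateGaussian 0 Γ)) - -(∫ ω : EuclideanSpace ℝ ι, exp (-U (ω + ψ)) * U' (ω + ψ) m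
        ∂(multivariateGaussian 0 Γ)) * ((∫ ω : EuclideanSpace ℝ ι, exp (-U (ω + ψ)) ∂(multivariateGaussian 0 Γ)) ^ 2)⁻¹ * (∫ ω : EuclideanSpace ℝ ι,
        exp (-U (ω + ψ)) * (U₃ (ω + ψ) h k l - U' (ω + ψ) k * U'' (ω + ψ) h l - U'' (ω + ψ) h k * U' (ω + ψ) l - U' (ω + ψ) h * U'' (ω + ψ) k l + U'
        (ω + ψ) h * U' (ω + ψ) k * U' (ω + ψ) l) ∂(multivariateGaussian 0 Γ)) + (((∫ ω : EuclideanSpace ℝ ι, exp (-U (ω + ψ)) ∂(multivariateGaussian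
        0 Γ)) ^ 2)⁻¹ * ((∫ ω : EuclideanSpace ℝ ι, exp (-U (ω + ψ)) * (U'' (ω + ψ) m h - U' (ω + ψ) h * U' (ω + ψ) m) ∂(multivariateGaussian 0 Γ)) *
        (∫ ω : EuclideanSpace ℝ ι, exp (-U (ω + ψ)) * (U'' (ω + ψ) k l - U' (ω + ψ) k * U' (ω + ψ) l) ∂(multivariateGaussian 0 Γ)) + (∫ ω :
        EuclideanSpace ℝ ι, exp (-U (ω + ψ)) * U' (ω + ψ) h ∂(multivariateGaussian 0 Γ)) * (∫ ω : EuclideanSpace ℝ ι, exp (-U (ω + ψ)) * (U₃ (ω + ψ)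
        m k l - U' (ω + ψ) k * U'' (ω + ψ) m l - U' (ω + ψ) l * U'' (ω + ψ) m k - (U'' (ω + ψ) k l - U' (ω + ψ) k * U' (ω + ψ) l) * U' (ω + ψ) m)
        ∂(multivariateGaussian 0 Γ))) - 2 * -(∫ ω : EuclideanSpace ℝ ι, exp (-U (ω + ψ)) * U' (ω + ψ) m ∂(multivariateGaussian 0 Γ)) * ((∫ ω :
        EuclideanSpace ℝ ι, exp (-U (ω + ψ)) ∂(multivariateGaussian 0 Γ)) ^ 3)⁻¹ * ((∫ ω : EuclideanSpace ℝ ι, exp (-U (ω + ψ)) * U' (ω + ψ) h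
        ∂(multivariateGaussian 0 Γ)) * (∫ ω : EuclideanSpace ℝ ι, exp (-U (ω + ψ)) * (U'' (ω + ψ) k l - U' (ω + ψ) k * U' (ω + ψ) l)
        ∂(multivariateGaussian 0 Γ)))) + (((∫ ω : EuclideanSpace ℝ ι, exp (-U (ω + ψ)) ∂(multivariateGaussian 0 Γ)) ^ 2)⁻¹ * ((∫ ω : EuclideanSpace
        ℝ ι, exp (-U (ω + ψ)) * (U'' (ω + ψ) m k - U' (ω + ψ) k * U' (ω + ψ) m) ∂(multivariateGaussian 0 Γ)) * (∫ ω : EuclideanSpace ℝ ι, exp (-U (ω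
        + ψ)) * (U'' (ω + ψ) h l - U' (ω + ψ) h * U' (ω + ψ) l) ∂(multivariateGaussian 0 Γ)) + (∫ ω : EuclideanSpace ℝ ι, exp (-U (ω + ψ)) * U' (ω +
        ψ) k ∂(multivariateGaussian 0 Γ)) * (∫ ω : EuclideanSpace ℝ ι, exp (-U (ω + ψ)) * (U₃ (ω + ψ) m h l - U' (ω + ψ) h * U'' (ω + ψ) m l - U' (ω
        + ψ) l * U'' (ω + ψ) m h - (U'' (ω + ψ) h l - U' (ω + ψ) h * U' (ω + ψ) l) * U' (ω + ψ) m) ∂(multivariateGaussian 0 Γ))) - 2 * -(∫ ω :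
        EuclideanSpace ℝ ι, exp (-U (ω + ψ)) * U' (ω + ψ) m ∂(multivariateGaussian 0 Γ)) * ((∫ ω : EuclideanSpace ℝ ι, exp (-U (ω + ψ))
        ∂(multivariateGaussian 0 Γ)) ^ 3)⁻¹ * ((∫ ω : EuclideanSpace ℝ ι, exp (-U (ω + ψ)) * U' (ω + ψ) k ∂(multivariateGaussian 0 Γ)) * (∫ ω :
        EuclideanSpace ℝ ι, exp (-U (ω + ψ)) * (U'' (ω + ψ) h l - U' (ω + ψ) h * U' (ω + ψ) l) ∂(multivariateGaussian 0 Γ)))) + (((∫ ω :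
        EuclideanSpace ℝ ι, exp (-U (ω + ψ)) ∂(multivariateGaussian 0 Γ)) ^ 2)⁻¹ * ((∫ ω : EuclideanSpace ℝ ι, exp (-U (ω + ψ)) * (U₃ (ω + ψ) m h k
        - U' (ω + ψ) h * U'' (ω + ψ) m k - U' (ω + ψ) k * U'' (ω + ψ) m h - (U'' (ω + ψ) h k - U' (ω + ψ) h * U' (ω + ψ) k) * U' (ω + ψ) m)
        ∂(multivariateGaussian 0 Γ)) * (∫ ω : EuclideanSpace ℝ ι, exp (-U (ω + ψ)) * U' (ω + ψ) l ∂(multivariateGaussian 0 Γ)) + (∫ ω :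
        EuclideanSpace ℝ ι, exp (-U (ω + ψ)) * (U'' (ω + ψ) h k - U' (ω + ψ) h * U' (ω + ψ) k) ∂(multivariateGaussian 0 Γ)) * (∫ ω : EuclideanSpace
        ℝ ι, exp (-U (ω + ψ)) * (U'' (ω + ψ) m l - U' (ω + ψ) l * U' (ω + ψ) m) ∂(multivariateGaussian 0 Γ))) - 2 * -(∫ ω : EuclideanSpace ℝ ι, exp
        (-U (ω + ψ)) * U' (ω + ψ) m ∂(multivariateGaussian 0 Γ)) * ((∫ ω : EuclideanSpace ℝ ι, exp (-U (ω + ψ)) ∂(multivariateGaussian 0 Γ)) ^ 3)⁻¹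
        * ((∫ ω : EuclideanSpace ℝ ι, exp (-U (ω + ψ)) * (U'' (ω + ψ) h k - U' (ω + ψ) h * U' (ω + ψ) k) ∂(multivariateGaussian 0 Γ)) * (∫ ω :
        EuclideanSpace ℝ ι, exp (-U (ω + ψ)) * U' (ω + ψ) l ∂(multivariateGaussian 0 Γ)))) + (2 * ((∫ ω : EuclideanSpace ℝ ι, exp (-U (ω + ψ))
        ∂(multivariateGaussian 0 Γ)) ^ 3)⁻¹ * ((∫ ω : EuclideanSpace ℝ ι, exp (-U (ω + ψ)) * (U'' (ω + ψ) m h - U' (ω + ψ) h * U' (ω + ψ) m)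
        ∂(multivariateGaussian 0 Γ)) * (∫ ω : EuclideanSpace ℝ ι, exp (-U (ω + ψ)) * U' (ω + ψ) k ∂(multivariateGaussian 0 Γ)) * (∫ ω :
        EuclideanSpace ℝ ι, exp (-U (ω + ψ)) * U' (ω + ψ) l ∂(multivariateGaussian 0 Γ)) + (∫ ω : EuclideanSpace ℝ ι, exp (-U (ω + ψ)) * U' (ω + ψ)
        h ∂(multivariateGaussian 0 Γ)) * (∫ ω : EuclideanSpace ℝ ι, exp (-U (ω + ψ)) * (U'' (ω + ψ) m k - U' (ω + ψ) k * U' (ω + ψ) m)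
        ∂(multivariateGaussian 0 Γ)) * (∫ ω : EuclideanSpace ℝ ι, exp (-U (ω + ψ)) * U' (ω + ψ) l ∂(multivariateGaussian 0 Γ)) + (∫ ω :
        EuclideanSpace ℝ ι, exp (-U (ω + ψ)) * U' (ω + ψ) h ∂(multivariateGaussian 0 Γ)) * (∫ ω : EuclideanSpace ℝ ι, exp (-U (ω + ψ)) * U' (ω + ψ)
        k ∂(multivariateGaussian 0 Γ)) * (∫ ω : EuclideanSpace ℝ ι, exp (-U (ω + ψ)) * (U'' (ω + ψ) m l - U' (ω + ψ) l * U' (ω + ψ) m)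
        ∂(multivariateGaussian 0 Γ))) - 6 * -(∫ ω : EuclideanSpace ℝ ι, exp (-U (ω + ψ)) * U' (ω + ψ) m ∂(multivariateGaussian 0 Γ)) * ((∫ ω :
        EuclideanSpace ℝ ι, exp (-U (ω + ψ)) ∂(multivariateGaussian 0 Γ)) ^ 4)⁻¹ * ((∫ ω : EuclideanSpace ℝ ι, exp (-U (ω + ψ)) * U' (ω + ψ) h
        ∂(multivariateGaussian 0 Γ)) * (∫ ω : EuclideanSpace ℝ ι, exp (-U (ω + ψ)) * U' (ω + ψ) k ∂(multivariateGaussian 0 Γ)) * (∫ ω :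
        EuclideanSpace ℝ ι, exp (-U (ω + ψ)) * U' (ω + ψ) l ∂(multivariateGaussian 0 Γ))))) ψ₀ := by
  have hU'c : Continuous U' := continuous_iff_continuousAt.2 fun φ => (hU'd φ).continuousAt
  have hU''c : Continuous U'' := continuous_iff_continuousAt.2 fun φ => (hU''d φ).continuousAt
  have hU₃c : Continuous U₃ := continuous_iff_continuousAt.2 fun φ => (hU₃d φ).continuousAt
  have hU₄c : Continuous U₄ := continuous_iff_continuousAt.2 fun φ => (hU₄d φ).continuousAt
  have hz0 : (∫ ω : EuclideanSpace ℝ ι, exp (-U (ω + ψ₀)) ∂(multivariateGaussian 0 Γ)) ≠ 0 := (block_Z_pos hΓ hΓop Y hUd hκ₀ hτ hδ hθ0 hθ1 hκθ hstab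
      ψ₀).ne'
  have hZ : ContDiffAt ℝ 1 (fun ψ : EuclideanSpace ℝ ι => ∫ ω : EuclideanSpace ℝ ι, exp (-U (ω + ψ)) ∂(multivariateGaussian 0 Γ)) ψ₀ :=
    (contDiff_one_Z hΓ hΓop Y hUd hU'c hκ₀ hκ₁ ha hτ hδ hθ1 hκθ hstab hU'b).contDiffAt
  have hGh := (contDiff_one_G hΓ hΓop Y hUd hU'd hU''c hκ₀ hκ₁ ha hτ hδ hθ1 hκθ hstab hU'b hU''b h hh).contDiffAt (x := ψ₀)
  have hGk := (contDiff_one_G hΓ hΓop Y hUd hU'd hU''c hκ₀ hκ₁ ha hτ hδ hθ1 hκθ hstab hU'b hU''b k hk).contDiffAt (x := ψ₀)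
  have hGl := (contDiff_one_G hΓ hΓop Y hUd hU'd hU''c hκ₀ hκ₁ ha hτ hδ hθ1 hκθ hstab hU'b hU''b l hl).contDiffAt (x := ψ₀)
  have hGm := (contDiff_one_G hΓ hΓop Y hUd hU'd hU''c hκ₀ hκ₁ ha hτ hδ hθ1 hκθ hstab hU'b hU''b m hm).contDiffAt (x := ψ₀)
  have hHhk := (contDiff_one_H hΓ hΓop Y hUd hU'd hU''d hU₃c hκ₀ hκ₁ ha hτ hδ hθ1 hκθ hstab hU'b hU''b hU₃b h k hh hk).contDiffAt (x := ψ₀)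
  have hHhl := (contDiff_one_H hΓ hΓop Y hUd hU'd hU''d hU₃c hκ₀ hκ₁ ha hτ hδ hθ1 hκθ hstab hU'b hU''b hU₃b h l hh hl).contDiffAt (x := ψ₀)
  have hHkl := (contDiff_one_H hΓ hΓop Y hUd hU'd hU''d hU₃c hκ₀ hκ₁ ha hτ hδ hθ1 hκθ hstab hU'b hU''b hU₃b k l hk hl).contDiffAt (x := ψ₀)
  have hHmh : ContDiffAt ℝ 1 (fun ψ : EuclideanSpace ℝ ι => ∫ ω : EuclideanSpace ℝ ι, exp (-U (ω + ψ)) * (U'' (ω + ψ) m h - U' (ω + ψ) h * U' (ω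
      + ψ) m) ∂(multivariateGaussian 0 Γ)) ψ₀ :=
    (contDiff_one_H hΓ hΓop Y hUd hU'd hU''d hU₃c hκ₀ hκ₁ ha hτ hδ hθ1 hκθ hstab hU'b hU''b hU₃b m h hm hh).contDiffAt.congr_of_eventuallyEq
      (Filter.Eventually.of_forall fun ψ => by beta_reduce; congr 1; funext ω; ring)
  have hHmk : ContDiffAt ℝ 1 (fun ψ : EuclideanSpace ℝ ι => ∫ ω : EuclideanSpace ℝ ι, exp (-U (ω + ψ)) * (U'' (ω + ψ) m k - U' (ω + ψ) k * U' (ω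
      + ψ) m) ∂(multivariateGaussian 0 Γ)) ψ₀ :=
    (contDiff_one_H hΓ hΓop Y hUd hU'd hU''d hU₃c hκ₀ hκ₁ ha hτ hδ hθ1 hκθ hstab hU'b hU''b hU₃b m k hm hk).contDiffAt.congr_of_eventuallyEq
      (Filter.Eventually.of_forall fun ψ => by beta_reduce; congr 1; funext ω; ring)
  have hHml : ContDiffAt ℝ 1 (fun ψ : EuclideanSpace ℝ ι => ∫ ω : EuclideanSpace ℝ ι, exp (-U (ω + ψ)) * (U'' (ω + ψ) m l - U' (ω + ψ) l * U' (ω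
      + ψ) m) ∂(multivariateGaussian 0 Γ)) ψ₀ :=
    (contDiff_one_H hΓ hΓop Y hUd hU'd hU''d hU₃c hκ₀ hκ₁ ha hτ hδ hθ1 hκθ hstab hU'b hU''b hU₃b m l hm hl).contDiffAt.congr_of_eventuallyEq
      (Filter.Eventually.of_forall fun ψ => by beta_reduce; congr 1; funext ω; ring)
  have hΦ := (contDiff_one_Phi hΓ hΓop Y hUd hU'd hU''d hU₃d hU₄c hκ₀ hκ₁ ha hτ hδ hθ1 hκθ hstab hU'b hU''b hU₃b hU₄b hh hk hl).contDiffAt (x := ψ₀)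
  have hΦmhk : ContDiffAt ℝ 1 (fun ψ : EuclideanSpace ℝ ι => ∫ ω : EuclideanSpace ℝ ι, exp (-U (ω + ψ)) * (U₃ (ω + ψ) m h k - U' (ω + ψ) h * U''
      (ω + ψ) m k - U' (ω + ψ) k * U'' (ω + ψ) m h - (U'' (ω + ψ) h k - U' (ω + ψ) h * U' (ω + ψ) k) * U' (ω + ψ) m) ∂(multivariateGaussian 0 Γ)) ψ₀
      :=
    (contDiff_one_Phi hΓ hΓop Y hUd hU'd hU''d hU₃d hU₄c hκ₀ hκ₁ ha hτ hδ hθ1 hκθ hstab hU'b hU''b hU₃b hU₄b hm hh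
        hk).contDiffAt.congr_of_eventuallyEq
      (Filter.Eventually.of_forall fun ψ => by beta_reduce; congr 1; funext ω; ring)
  have hΦmkl : ContDiffAt ℝ 1 (fun ψ : EuclideanSpace ℝ ι => ∫ ω : EuclideanSpace ℝ ι, exp (-U (ω + ψ)) * (U₃ (ω + ψ) m k l - U' (ω + ψ) k * U''
      (ω + ψ) m l - U' (ω + ψ) l * U'' (ω + ψ) m k - (U'' (ω + ψ) k l - U' (ω + ψ) k * U' (ω + ψ) l) * U' (ω + ψ) m) ∂(multivariateGaussian 0 Γ)) ψ₀
      :=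
    (contDiff_one_Phi hΓ hΓop Y hUd hU'd hU''d hU₃d hU₄c hκ₀ hκ₁ ha hτ hδ hθ1 hκθ hstab hU'b hU''b hU₃b hU₄b hm hk
        hl).contDiffAt.congr_of_eventuallyEq
      (Filter.Eventually.of_forall fun ψ => by beta_reduce; congr 1; funext ω; ring)
  have hΦmhl : ContDiffAt ℝ 1 (fun ψ : EuclideanSpace ℝ ι => ∫ ω : EuclideanSpace ℝ ι, exp (-U (ω + ψ)) * (U₃ (ω + ψ) m h l - U' (ω + ψ) h * U''
      (ω + ψ) m l - U' (ω + ψ) l * U'' (ω + ψ) m h - (U'' (ω + ψ) h l - U' (ω + ψ) h * U' (ω + ψ) l) * U' (ω + ψ) m) ∂(multivariateGaussian 0 Γ)) ψ₀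
      :=
    (contDiff_one_Phi hΓ hΓop Y hUd hU'd hU''d hU₃d hU₄c hκ₀ hκ₁ ha hτ hδ hθ1 hκθ hstab hU'b hU''b hU₃b hU₄b hm hh
        hl).contDiffAt.congr_of_eventuallyEq
      (Filter.Eventually.of_forall fun ψ => by beta_reduce; congr 1; funext ω; ring)
  have hΨ := (contDiff_one_psi_moment hΓ hΓop Y hUd hU'd hU''d hU₃d hU₄d hU₅c hκ₀ hκ₁ ha hτ hδ hθ1 hκθ hstab hU'b hU''b hU₃b hU₄b
    hU₅b m h k l).contDiffAt (x := ψ₀)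
  fun_prop (disch := first | assumption | exact pow_ne_zero _ hz0)

/-! ## §2. THE END: the Fréchet derivative of the centred display is continuous in the background -/

set_option maxHeartbeats 4000000 in
/-- **THE END: `fderiv ℝ (ψ ↦ ∂⁴W(ψ)[h,k,l,m])` — (521)'s CENTRED display, whose derivative's entries are the fifth-order objects of
(600)∕(610)∕(639) — is CONTINUOUS in the background** (directions of norm `≤ 1`): §1 transported along (521) `raw_eq_centred` at every `ψ`
gives `ContDiffAt ℝ 1` everywhere, i.e. `ContDiff ℝ 1`, then `ContDiff.continuous_fderiv`. [folklore] -/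
theorem continuous_fderiv_fourth_form (hΓ : Γ.PosSemidef) (hΓop : (γop • (1 : Matrix ι ι ℝ) - Γ).PosSemidef) (Y : Finset ι) (hUd : ∀ φ :
      EuclideanSpace ℝ ι, HasFDerivAt U (U' φ) φ) (hU'd : ∀ φ : EuclideanSpace ℝ ι, HasFDerivAt U' (U'' φ) φ) (hU''d : ∀ φ : EuclideanSpace ℝ ι,
      HasFDerivAt U'' (U₃ φ) φ) (hU₃d : ∀ φ : EuclideanSpace ℝ ι, HasFDerivAt U₃ (U₄ φ) φ) (hU₄d : ∀ φ : EuclideanSpace ℝ ι, HasFDerivAt U₄ (U₅ φ)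
      φ) (hU₅c : Continuous U₅) (hκ₀ : 0 ≤ κ₀) (hκ₁ : 0 ≤ κ₁) (ha : 0 ≤ a) (hτ : 0 < τ) (hδ : 0 < δ) (hθ1 : θ < 1) (hκθ : (2 * κ₀ * (1 + τ) + 4 * δ)
      * γop ≤ θ) (hstab : ∀ φ : EuclideanSpace ℝ ι, -(κ₀ * ∑ x ∈ Y, φ x ^ 2) ≤ U φ) (hU'b : ∀ φ : EuclideanSpace ℝ ι, ‖U' φ‖ ≤ κ₁ * (a + ∑ x ∈ Y, φ
      x ^ 2)) (hθ0 : 0 < θ) (hU''b : ∀ φ : EuclideanSpace ℝ ι, ‖U'' φ‖ ≤ κ₂) (hU₃b : ∀ φ : EuclideanSpace ℝ ι, ‖U₃ φ‖ ≤ κ₃) (hU₄b : ∀ φ :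
      EuclideanSpace ℝ ι, ‖U₄ φ‖ ≤ κ₄) (hU₅b : ∀ φ : EuclideanSpace ℝ ι, ‖U₅ φ‖ ≤ κ₅) (hh : ‖h‖ ≤ 1) (hk : ‖k‖ ≤ 1) (hl : ‖l‖ ≤ 1) (hm : ‖m‖ ≤ 1) :
    Continuous (fderiv ℝ (fun ψ : EuclideanSpace ℝ ι => (∫ ω : EuclideanSpace ℝ ι, exp (-U (ω + ψ)) ∂(multivariateGaussian 0 Γ))⁻¹ * (∫ ω :
        EuclideanSpace ℝ ι, exp (-U (ω + ψ)) * U₄ (ω + ψ) m h k l ∂(multivariateGaussian 0 Γ)) - (((∫ ω : EuclideanSpace ℝ ι, exp (-U (ω + ψ))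
        ∂(multivariateGaussian 0 Γ))⁻¹ * (∫ ω : EuclideanSpace ℝ ι, exp (-U (ω + ψ)) * (U₃ (ω + ψ) m k l * U' (ω + ψ) h) ∂(multivariateGaussian 0
        Γ)) - ((∫ ω : EuclideanSpace ℝ ι, exp (-U (ω + ψ)) ∂(multivariateGaussian 0 Γ)) ^ 2)⁻¹ * ((∫ ω : EuclideanSpace ℝ ι, exp (-U (ω + ψ)) * U₃
        (ω + ψ) m k l ∂(multivariateGaussian 0 Γ)) * (∫ ω : EuclideanSpace ℝ ι, exp (-U (ω + ψ)) * U' (ω + ψ) h ∂(multivariateGaussian 0 Γ)))) + ((∫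
        ω : EuclideanSpace ℝ ι, exp (-U (ω + ψ)) ∂(multivariateGaussian 0 Γ))⁻¹ * (∫ ω : EuclideanSpace ℝ ι, exp (-U (ω + ψ)) * (U₃ (ω + ψ) m h l *
        U' (ω + ψ) k) ∂(multivariateGaussian 0 Γ)) - ((∫ ω : EuclideanSpace ℝ ι, exp (-U (ω + ψ)) ∂(multivariateGaussian 0 Γ)) ^ 2)⁻¹ * ((∫ ω :
        EuclideanSpace ℝ ι, exp (-U (ω + ψ)) * U₃ (ω + ψ) m h l ∂(multivariateGaussian 0 Γ)) * (∫ ω : EuclideanSpace ℝ ι, exp (-U (ω + ψ)) * U' (ω +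
        ψ) k ∂(multivariateGaussian 0 Γ)))) + ((∫ ω : EuclideanSpace ℝ ι, exp (-U (ω + ψ)) ∂(multivariateGaussian 0 Γ))⁻¹ * (∫ ω : EuclideanSpace ℝ
        ι, exp (-U (ω + ψ)) * (U₃ (ω + ψ) m h k * U' (ω + ψ) l) ∂(multivariateGaussian 0 Γ)) - ((∫ ω : EuclideanSpace ℝ ι, exp (-U (ω + ψ))
        ∂(multivariateGaussian 0 Γ)) ^ 2)⁻¹ * ((∫ ω : EuclideanSpace ℝ ι, exp (-U (ω + ψ)) * U₃ (ω + ψ) m h k ∂(multivariateGaussian 0 Γ)) * (∫ ω :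
        EuclideanSpace ℝ ι, exp (-U (ω + ψ)) * U' (ω + ψ) l ∂(multivariateGaussian 0 Γ)))) + ((∫ ω : EuclideanSpace ℝ ι, exp (-U (ω + ψ))
        ∂(multivariateGaussian 0 Γ))⁻¹ * (∫ ω : EuclideanSpace ℝ ι, exp (-U (ω + ψ)) * (U' (ω + ψ) m * U₃ (ω + ψ) h k l) ∂(multivariateGaussian 0
        Γ)) - ((∫ ω : EuclideanSpace ℝ ι, exp (-U (ω + ψ)) ∂(multivariateGaussian 0 Γ)) ^ 2)⁻¹ * ((∫ ω : EuclideanSpace ℝ ι, exp (-U (ω + ψ)) * U'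
        (ω + ψ) m ∂(multivariateGaussian 0 Γ)) * (∫ ω : EuclideanSpace ℝ ι, exp (-U (ω + ψ)) * U₃ (ω + ψ) h k l ∂(multivariateGaussian 0 Γ))))) -
        (((∫ ω : EuclideanSpace ℝ ι, exp (-U (ω + ψ)) ∂(multivariateGaussian 0 Γ))⁻¹ * (∫ ω : EuclideanSpace ℝ ι, exp (-U (ω + ψ)) * (U'' (ω + ψ) m
        h * U'' (ω + ψ) k l) ∂(multivariateGaussian 0 Γ)) - ((∫ ω : EuclideanSpace ℝ ι, exp (-U (ω + ψ)) ∂(multivariateGaussian 0 Γ)) ^ 2)⁻¹ * ((∫ ω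
        : EuclideanSpace ℝ ι, exp (-U (ω + ψ)) * U'' (ω + ψ) m h ∂(multivariateGaussian 0 Γ)) * (∫ ω : EuclideanSpace ℝ ι, exp (-U (ω + ψ)) * U'' (ω
        + ψ) k l ∂(multivariateGaussian 0 Γ)))) + ((∫ ω : EuclideanSpace ℝ ι, exp (-U (ω + ψ)) ∂(multivariateGaussian 0 Γ))⁻¹ * (∫ ω :
        EuclideanSpace ℝ ι, exp (-U (ω + ψ)) * (U'' (ω + ψ) m k * U'' (ω + ψ) h l) ∂(multivariateGaussian 0 Γ)) - ((∫ ω : EuclideanSpace ℝ ι, exp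
        (-U (ω + ψ)) ∂(multivariateGaussian 0 Γ)) ^ 2)⁻¹ * ((∫ ω : EuclideanSpace ℝ ι, exp (-U (ω + ψ)) * U'' (ω + ψ) m k ∂(multivariateGaussian 0
        Γ)) * (∫ ω : EuclideanSpace ℝ ι, exp (-U (ω + ψ)) * U'' (ω + ψ) h l ∂(multivariateGaussian 0 Γ)))) + ((∫ ω : EuclideanSpace ℝ ι, exp (-U (ω
        + ψ)) ∂(multivariateGaussian 0 Γ))⁻¹ * (∫ ω : EuclideanSpace ℝ ι, exp (-U (ω + ψ)) * (U'' (ω + ψ) m l * U'' (ω + ψ) h k)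
        ∂(multivariateGaussian 0 Γ)) - ((∫ ω : EuclideanSpace ℝ ι, exp (-U (ω + ψ)) ∂(multivariateGaussian 0 Γ)) ^ 2)⁻¹ * ((∫ ω : EuclideanSpace ℝ
        ι, exp (-U (ω + ψ)) * U'' (ω + ψ) m l ∂(multivariateGaussian 0 Γ)) * (∫ ω : EuclideanSpace ℝ ι, exp (-U (ω + ψ)) * U'' (ω + ψ) h k
        ∂(multivariateGaussian 0 Γ))))) + ((∫ ω : EuclideanSpace ℝ ι, exp (-U (ω + ψ)) ∂(multivariateGaussian 0 Γ))⁻¹ * (∫ ω : EuclideanSpace ℝ ι,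
        exp (-U (ω + ψ)) * ((U'' (ω + ψ) m h - ((∫ ω : EuclideanSpace ℝ ι, exp (-U (ω + ψ)) ∂(multivariateGaussian 0 Γ))⁻¹ * (∫ ω : EuclideanSpace ℝ
        ι, exp (-U (ω + ψ)) * U'' (ω + ψ) m h ∂(multivariateGaussian 0 Γ)))) * (U' (ω + ψ) k - ((∫ ω : EuclideanSpace ℝ ι, exp (-U (ω + ψ))
        ∂(multivariateGaussian 0 Γ))⁻¹ * (∫ ω : EuclideanSpace ℝ ι, exp (-U (ω + ψ)) * U' (ω + ψ) k ∂(multivariateGaussian 0 Γ)))) * (U' (ω + ψ) l -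
        ((∫ ω : EuclideanSpace ℝ ι, exp (-U (ω + ψ)) ∂(multivariateGaussian 0 Γ))⁻¹ * (∫ ω : EuclideanSpace ℝ ι, exp (-U (ω + ψ)) * U' (ω + ψ) l
        ∂(multivariateGaussian 0 Γ))))) ∂(multivariateGaussian 0 Γ)) + (∫ ω : EuclideanSpace ℝ ι, exp (-U (ω + ψ)) ∂(multivariateGaussian 0 Γ))⁻¹ *
        (∫ ω : EuclideanSpace ℝ ι, exp (-U (ω + ψ)) * ((U'' (ω + ψ) m k - ((∫ ω : EuclideanSpace ℝ ι, exp (-U (ω + ψ)) ∂(multivariateGaussian 0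
        Γ))⁻¹ * (∫ ω : EuclideanSpace ℝ ι, exp (-U (ω + ψ)) * U'' (ω + ψ) m k ∂(multivariateGaussian 0 Γ)))) * (U' (ω + ψ) h - ((∫ ω :
        EuclideanSpace ℝ ι, exp (-U (ω + ψ)) ∂(multivariateGaussian 0 Γ))⁻¹ * (∫ ω : EuclideanSpace ℝ ι, exp (-U (ω + ψ)) * U' (ω + ψ) h
        ∂(multivariateGaussian 0 Γ)))) * (U' (ω + ψ) l - ((∫ ω : EuclideanSpace ℝ ι, exp (-U (ω + ψ)) ∂(multivariateGaussian 0 Γ))⁻¹ * (∫ ω :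
        EuclideanSpace ℝ ι, exp (-U (ω + ψ)) * U' (ω + ψ) l ∂(multivariateGaussian 0 Γ))))) ∂(multivariateGaussian 0 Γ)) + (∫ ω : EuclideanSpace ℝ
        ι, exp (-U (ω + ψ)) ∂(multivariateGaussian 0 Γ))⁻¹ * (∫ ω : EuclideanSpace ℝ ι, exp (-U (ω + ψ)) * ((U'' (ω + ψ) m l - ((∫ ω :
        EuclideanSpace ℝ ι, exp (-U (ω + ψ)) ∂(multivariateGaussian 0 Γ))⁻¹ * (∫ ω : EuclideanSpace ℝ ι, exp (-U (ω + ψ)) * U'' (ω + ψ) m l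
        ∂(multivariateGaussian 0 Γ)))) * (U' (ω + ψ) h - ((∫ ω : EuclideanSpace ℝ ι, exp (-U (ω + ψ)) ∂(multivariateGaussian 0 Γ))⁻¹ * (∫ ω :
        EuclideanSpace ℝ ι, exp (-U (ω + ψ)) * U' (ω + ψ) h ∂(multivariateGaussian 0 Γ)))) * (U' (ω + ψ) k - ((∫ ω : EuclideanSpace ℝ ι, exp (-U (ω
        + ψ)) ∂(multivariateGaussian 0 Γ))⁻¹ * (∫ ω : EuclideanSpace ℝ ι, exp (-U (ω + ψ)) * U' (ω + ψ) k ∂(multivariateGaussian 0 Γ)))))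
        ∂(multivariateGaussian 0 Γ)) + (∫ ω : EuclideanSpace ℝ ι, exp (-U (ω + ψ)) ∂(multivariateGaussian 0 Γ))⁻¹ * (∫ ω : EuclideanSpace ℝ ι, exp
        (-U (ω + ψ)) * ((U' (ω + ψ) m - ((∫ ω : EuclideanSpace ℝ ι, exp (-U (ω + ψ)) ∂(multivariateGaussian 0 Γ))⁻¹ * (∫ ω : EuclideanSpace ℝ ι, exp
        (-U (ω + ψ)) * U' (ω + ψ) m ∂(multivariateGaussian 0 Γ)))) * (U'' (ω + ψ) h k - ((∫ ω : EuclideanSpace ℝ ι, exp (-U (ω + ψ))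
        ∂(multivariateGaussian 0 Γ))⁻¹ * (∫ ω : EuclideanSpace ℝ ι, exp (-U (ω + ψ)) * U'' (ω + ψ) h k ∂(multivariateGaussian 0 Γ)))) * (U' (ω + ψ)
        l - ((∫ ω : EuclideanSpace ℝ ι, exp (-U (ω + ψ)) ∂(multivariateGaussian 0 Γ))⁻¹ * (∫ ω : EuclideanSpace ℝ ι, exp (-U (ω + ψ)) * U' (ω + ψ) l
        ∂(multivariateGaussian 0 Γ))))) ∂(multivariateGaussian 0 Γ)) + (∫ ω : EuclideanSpace ℝ ι, exp (-U (ω + ψ)) ∂(multivariateGaussian 0 Γ))⁻¹ *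
        (∫ ω : EuclideanSpace ℝ ι, exp (-U (ω + ψ)) * ((U' (ω + ψ) m - ((∫ ω : EuclideanSpace ℝ ι, exp (-U (ω + ψ)) ∂(multivariateGaussian 0 Γ))⁻¹ *
        (∫ ω : EuclideanSpace ℝ ι, exp (-U (ω + ψ)) * U' (ω + ψ) m ∂(multivariateGaussian 0 Γ)))) * (U'' (ω + ψ) h l - ((∫ ω : EuclideanSpace ℝ ι,
        exp (-U (ω + ψ)) ∂(multivariateGaussian 0 Γ))⁻¹ * (∫ ω : EuclideanSpace ℝ ι, exp (-U (ω + ψ)) * U'' (ω + ψ) h l ∂(multivariateGaussian 0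
        Γ)))) * (U' (ω + ψ) k - ((∫ ω : EuclideanSpace ℝ ι, exp (-U (ω + ψ)) ∂(multivariateGaussian 0 Γ))⁻¹ * (∫ ω : EuclideanSpace ℝ ι, exp (-U (ω
        + ψ)) * U' (ω + ψ) k ∂(multivariateGaussian 0 Γ))))) ∂(multivariateGaussian 0 Γ)) + (∫ ω : EuclideanSpace ℝ ι, exp (-U (ω + ψ))
        ∂(multivariateGaussian 0 Γ))⁻¹ * (∫ ω : EuclideanSpace ℝ ι, exp (-U (ω + ψ)) * ((U' (ω + ψ) m - ((∫ ω : EuclideanSpace ℝ ι, exp (-U (ω + ψ))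
        ∂(multivariateGaussian 0 Γ))⁻¹ * (∫ ω : EuclideanSpace ℝ ι, exp (-U (ω + ψ)) * U' (ω + ψ) m ∂(multivariateGaussian 0 Γ)))) * (U'' (ω + ψ) k
        l - ((∫ ω : EuclideanSpace ℝ ι, exp (-U (ω + ψ)) ∂(multivariateGaussian 0 Γ))⁻¹ * (∫ ω : EuclideanSpace ℝ ι, exp (-U (ω + ψ)) * U'' (ω + ψ)
        k l ∂(multivariateGaussian 0 Γ)))) * (U' (ω + ψ) h - ((∫ ω : EuclideanSpace ℝ ι, exp (-U (ω + ψ)) ∂(multivariateGaussian 0 Γ))⁻¹ * (∫ ω :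
        EuclideanSpace ℝ ι, exp (-U (ω + ψ)) * U' (ω + ψ) h ∂(multivariateGaussian 0 Γ))))) ∂(multivariateGaussian 0 Γ))) - ((∫ ω : EuclideanSpace ℝ
        ι, exp (-U (ω + ψ)) ∂(multivariateGaussian 0 Γ))⁻¹ * (∫ ω : EuclideanSpace ℝ ι, exp (-U (ω + ψ)) * ((U' (ω + ψ) m - ((∫ ω : EuclideanSpace ℝ
        ι, exp (-U (ω + ψ)) ∂(multivariateGaussian 0 Γ))⁻¹ * (∫ ω : EuclideanSpace ℝ ι, exp (-U (ω + ψ)) * U' (ω + ψ) m ∂(multivariateGaussian 0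
        Γ)))) * (U' (ω + ψ) h - ((∫ ω : EuclideanSpace ℝ ι, exp (-U (ω + ψ)) ∂(multivariateGaussian 0 Γ))⁻¹ * (∫ ω : EuclideanSpace ℝ ι, exp (-U (ω
        + ψ)) * U' (ω + ψ) h ∂(multivariateGaussian 0 Γ)))) * (U' (ω + ψ) k - ((∫ ω : EuclideanSpace ℝ ι, exp (-U (ω + ψ)) ∂(multivariateGaussian 0
        Γ))⁻¹ * (∫ ω : EuclideanSpace ℝ ι, exp (-U (ω + ψ)) * U' (ω + ψ) k ∂(multivariateGaussian 0 Γ)))) * (U' (ω + ψ) l - ((∫ ω : EuclideanSpace ℝ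
        ι, exp (-U (ω + ψ)) ∂(multivariateGaussian 0 Γ))⁻¹ * (∫ ω : EuclideanSpace ℝ ι, exp (-U (ω + ψ)) * U' (ω + ψ) l ∂(multivariateGaussian 0
        Γ))))) ∂(multivariateGaussian 0 Γ)) - ((∫ ω : EuclideanSpace ℝ ι, exp (-U (ω + ψ)) ∂(multivariateGaussian 0 Γ))⁻¹ * (∫ ω : EuclideanSpace ℝ
        ι, exp (-U (ω + ψ)) * ((U' (ω + ψ) m - ((∫ ω : EuclideanSpace ℝ ι, exp (-U (ω + ψ)) ∂(multivariateGaussian 0 Γ))⁻¹ * (∫ ω : EuclideanSpace ℝ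
        ι, exp (-U (ω + ψ)) * U' (ω + ψ) m ∂(multivariateGaussian 0 Γ)))) * (U' (ω + ψ) h - ((∫ ω : EuclideanSpace ℝ ι, exp (-U (ω + ψ))
        ∂(multivariateGaussian 0 Γ))⁻¹ * (∫ ω : EuclideanSpace ℝ ι, exp (-U (ω + ψ)) * U' (ω + ψ) h ∂(multivariateGaussian 0 Γ)))))
        ∂(multivariateGaussian 0 Γ))) * ((∫ ω : EuclideanSpace ℝ ι, exp (-U (ω + ψ)) ∂(multivariateGaussian 0 Γ))⁻¹ * (∫ ω : EuclideanSpace ℝ ι, exp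
        (-U (ω + ψ)) * ((U' (ω + ψ) k - ((∫ ω : EuclideanSpace ℝ ι, exp (-U (ω + ψ)) ∂(multivariateGaussian 0 Γ))⁻¹ * (∫ ω : EuclideanSpace ℝ ι, exp
        (-U (ω + ψ)) * U' (ω + ψ) k ∂(multivariateGaussian 0 Γ)))) * (U' (ω + ψ) l - ((∫ ω : EuclideanSpace ℝ ι, exp (-U (ω + ψ))
        ∂(multivariateGaussian 0 Γ))⁻¹ * (∫ ω : EuclideanSpace ℝ ι, exp (-U (ω + ψ)) * U' (ω + ψ) l ∂(multivariateGaussian 0 Γ)))))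
        ∂(multivariateGaussian 0 Γ))) - ((∫ ω : EuclideanSpace ℝ ι, exp (-U (ω + ψ)) ∂(multivariateGaussian 0 Γ))⁻¹ * (∫ ω : EuclideanSpace ℝ ι, exp
        (-U (ω + ψ)) * ((U' (ω + ψ) m - ((∫ ω : EuclideanSpace ℝ ι, exp (-U (ω + ψ)) ∂(multivariateGaussian 0 Γ))⁻¹ * (∫ ω : EuclideanSpace ℝ ι, exp
        (-U (ω + ψ)) * U' (ω + ψ) m ∂(multivariateGaussian 0 Γ)))) * (U' (ω + ψ) k - ((∫ ω : EuclideanSpace ℝ ι, exp (-U (ω + ψ))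
        ∂(multivariateGaussian 0 Γ))⁻¹ * (∫ ω : EuclideanSpace ℝ ι, exp (-U (ω + ψ)) * U' (ω + ψ) k ∂(multivariateGaussian 0 Γ)))))
        ∂(multivariateGaussian 0 Γ))) * ((∫ ω : EuclideanSpace ℝ ι, exp (-U (ω + ψ)) ∂(multivariateGaussian 0 Γ))⁻¹ * (∫ ω : EuclideanSpace ℝ ι, exp
        (-U (ω + ψ)) * ((U' (ω + ψ) h - ((∫ ω : EuclideanSpace ℝ ι, exp (-U (ω + ψ)) ∂(multivariateGaussian 0 Γ))⁻¹ * (∫ ω : EuclideanSpace ℝ ι, exp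
        (-U (ω + ψ)) * U' (ω + ψ) h ∂(multivariateGaussian 0 Γ)))) * (U' (ω + ψ) l - ((∫ ω : EuclideanSpace ℝ ι, exp (-U (ω + ψ))
        ∂(multivariateGaussian 0 Γ))⁻¹ * (∫ ω : EuclideanSpace ℝ ι, exp (-U (ω + ψ)) * U' (ω + ψ) l ∂(multivariateGaussian 0 Γ)))))
        ∂(multivariateGaussian 0 Γ))) - ((∫ ω : EuclideanSpace ℝ ι, exp (-U (ω + ψ)) ∂(multivariateGaussian 0 Γ))⁻¹ * (∫ ω : EuclideanSpace ℝ ι, exp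
        (-U (ω + ψ)) * ((U' (ω + ψ) m - ((∫ ω : EuclideanSpace ℝ ι, exp (-U (ω + ψ)) ∂(multivariateGaussian 0 Γ))⁻¹ * (∫ ω : EuclideanSpace ℝ ι, exp
        (-U (ω + ψ)) * U' (ω + ψ) m ∂(multivariateGaussian 0 Γ)))) * (U' (ω + ψ) l - ((∫ ω : EuclideanSpace ℝ ι, exp (-U (ω + ψ))
        ∂(multivariateGaussian 0 Γ))⁻¹ * (∫ ω : EuclideanSpace ℝ ι, exp (-U (ω + ψ)) * U' (ω + ψ) l ∂(multivariateGaussian 0 Γ)))))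
        ∂(multivariateGaussian 0 Γ))) * ((∫ ω : EuclideanSpace ℝ ι, exp (-U (ω + ψ)) ∂(multivariateGaussian 0 Γ))⁻¹ * (∫ ω : EuclideanSpace ℝ ι, exp
        (-U (ω + ψ)) * ((U' (ω + ψ) h - ((∫ ω : EuclideanSpace ℝ ι, exp (-U (ω + ψ)) ∂(multivariateGaussian 0 Γ))⁻¹ * (∫ ω : EuclideanSpace ℝ ι, exp
        (-U (ω + ψ)) * U' (ω + ψ) h ∂(multivariateGaussian 0 Γ)))) * (U' (ω + ψ) k - ((∫ ω : EuclideanSpace ℝ ι, exp (-U (ω + ψ))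
        ∂(multivariateGaussian 0 Γ))⁻¹ * (∫ ω : EuclideanSpace ℝ ι, exp (-U (ω + ψ)) * U' (ω + ψ) k ∂(multivariateGaussian 0 Γ)))))
        ∂(multivariateGaussian 0 Γ)))))) := by
  have hU'c : Continuous U' := continuous_iff_continuousAt.2 fun φ => (hU'd φ).continuousAt
  have hU''c : Continuous U'' := continuous_iff_continuousAt.2 fun φ => (hU''d φ).continuousAt
  have hU₃c : Continuous U₃ := continuous_iff_continuousAt.2 fun φ => (hU₃d φ).continuousAt
  have hU₄c : Continuous U₄ := continuous_iff_continuousAt.2 fun φ => (hU₄d φ).continuousAt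
  refine (contDiff_iff_contDiffAt.2 fun ψ₀ => ?_).continuous_fderiv one_ne_zero
  exact (contDiffAt_fourth_form_raw hΓ hΓop Y hUd hU'd hU''d hU₃d hU₄d hU₅c hκ₀ hκ₁ ha hτ hδ hθ1 hκθ hstab hU'b hθ0 hU''b hU₃b hU₄b hU₅b ψ₀ hh hk hl
      hm).congr_of_eventuallyEq (Filter.Eventually.of_forall fun ψ => (raw_eq_centred hΓ hΓop Y hUd hU'c hU''c hU₃c hU₄c hU''b hU₃b hU₄b hκ₀ hκ₁ ha
      hτ hδ hθ1 hκθ hstab hU'b hθ0 ψ h k l m).symm)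

end Main

/-! ## §3. Toy -/

/-- Toy (§2's last step in one variable): a `C¹` function has a continuous derivative. -/
example (f : ℝ → ℝ) (hf : ContDiff ℝ 1 f) : Continuous (fderiv ℝ f) := hf.continuous_fderiv one_ne_zero

end Summit.QuantumFields.BalabanUV.T4Continuum.NE7b.SupFourthFormContDiff

end
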